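import Summits.HodgeConjecture.HodgeConjecture.Theorems.Ring2HypothesesWeilComponentsCM
import Literature.AlgebraicGeometry.HodgeTheory.WeilClassesFieldRationalSpan
import HarnessLib

/-!
# Ring 2 — hypotheses layer, part VII-D: the `(E, 2k, δ)`-components on the ladder — on-path lemmas, slices of R3 / R3var / T6-CM, exactness of the δ-indexing, T6(δ)-CM

HONEST FRAMING: research route conditional on HC_CM; not a corollary; Q11.4-sentence-2 already refuted in dim ≥ 3.

Cell `pub-hodge-ring2`, seat `pub-hodge-ring2-typer2`, gen 7; companion of part VII-C (`Ring2HypothesesWeilComponentsCM`: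
the targets `WeilClassesWeilTypeCM`, `WeilClassesComponentCM R e₀ k δ`, the δ-leaves and rows W1-CM / W1′-CM). `HC_CM` is
the binder `(hCM : Theses.RankFourFaces.CMAbelianHodge)` by name; theorems only (no new `def`).

## What this file adds

* ON-PATH: `WeilClassesWeilTypeCM`, every `WeilClassesComponentCM R e₀ k δ`, every δ-VHC leaf, every T6(δ)-CM target and
  the ANCHORED δ-leaf (constant family `A.X ⟶ Spec ℂ`) are cases of the summit; `HC_AV ⟹ WeilClassesWeilTypeCM`.
* SLICES: R3 ⟹ `WeilClassesWeilTypeCM` ⟹ each component; R3var ⟹ each δ-VHC leaf (the CM data of `P = R(T²)` are read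
  off any chart); T6-CM ⟹ T6(δ)-CM.
* EXACTNESS W3-CM: `WeilClassesWeilTypeCM ↔ WeilClassesByComponentCM` GRANTED the typed supply statement
  `PolarizedWeilDiscriminantCMExists` (Deligne p. 30 (1), Lemma 4.6, Thm. 4.8 (a); `[status: open]`, never asserted).
* T6(δ)-CM: `WeilClassesComponentCM R e₀ k δ → (#24) → (MZ) → HodgeGeneralWeilTypeComponentCM R e₀ k δ` and the row
  `HC_CM → CMPointed… → δ-VHC → (#24) → (MZ) → T6(δ)-CM`; `WeilClassesWeilTypeCM → (#24) → (MZ) → T6-CM` — the descent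
  input of the transport file being now the THEOREM `HodgeTheory.weilClassesField_le_span_isRationalClass`
  (Moonen–Zarhin's `W_E ⊗ ℂ` is spanned by its rational members, under `IsWeilTypeCM`'s hypotheses).

Honest column: fact #24 is UNREFEREED for `e₀ ≥ 2` (Milne's endnote 16); every δ-VHC leaf is OPEN; `HC_CM` nominal.

## References

* [Deligne1982HodgeCycles] LNM 900 §4: p. 30 (1), Prop. 4.1, (4.4), Prop. 4.4, Lemma 4.6, Thm. 4.8; §5; Milne 2003
  re-edition endnote 16 (UNREFEREED). [MoonenZarhin1998WeilClasses] §1. [CharlesSchnell2014Notes] Conj. 11.3.1,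
  Cor. 11.3.6. [Deligne2000] §1. [Markman2025SurveySecant] §12 (UNREFEREED).
-/

set_option linter.dupNamespace false

noncomputable section

open CategoryTheory
open Literature.AlgebraicGeometry Literature.AlgebraicGeometry.Motives
open Literature.AlgebraicGeometry.HodgeTheory
open Literature.AlgebraicGeometry.Deligne1982
open Literature.AlgebraicTopology.SingularHomology
open Literature.AlgebraicGeometry.Milne1999 (IsOfCMType)
open Literature.AlgebraicGeometry.VanGeemen1994 (pullbackOne)
open Summit.HodgeConjecture.HodgeConjecture.WeilTypeLadder
open Summit.HodgeConjecture.HodgeConjecture.Theses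
open Summit.HodgeConjecture.HodgeConjecture.Theorems (isSmoothProjectiveFamily_toSpecOver' isIso_fiberι_toSpecOver')
open Summit.HodgeConjecture.HodgeConjecture.Ring2Transport

namespace Summit.HodgeConjecture.HodgeConjecture.Ring2.Hypotheses

/-! ### §3 On-path lemmas, slices of R3 / R3var, and exactness of the δ-indexing -/

/-- R3 ⟹ its rendering on Deligne's carriers (the transport seat's junction lemma `weilClassesCMField_isWeilTypeCM`).
[cite: Deligne1982HodgeCycles, §4 (4.4)] [cite: MoonenZarhin1998WeilClasses, §1] -/
theorem weilClassesWeilTypeCM_of_weilClassesCMField (hR3 : WeilClassesCMField) : WeilClassesWeilTypeCM :=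
  fun _ _ _ _ _ he hW ↦ weilClassesCMField_isWeilTypeCM hR3 he hW

/-- ON-PATH: `WeilClassesWeilTypeCM` is a case of the summit. [cite: Deligne2000, §1] -/
theorem weilClassesWeilTypeCM_of_hodgeConjecture (h : _root_.HodgeConjecture) : WeilClassesWeilTypeCM :=
  fun _ _ _ _ k _ hW c _ hcQ hcH ↦ (h hW.isSmoothProjective).2 k c hcQ hcH

/-- ON-PATH: `HC_AV → WeilClassesWeilTypeCM`. [cite: Deligne2000, §1] -/
theorem weilClassesWeilTypeCM_of_hodgeAbelianVarieties (h : PadicSemiregularLift.HodgeAbelianVarieties) :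
    WeilClassesWeilTypeCM :=
  fun A _ _ _ k _ _ c _ hcQ hcH ↦ (h A).2 k c hcQ hcH

section Slices

variable {R : Polynomial ℤ} [Fact (Irreducible (realPolyQ R))] {e₀ k : ℕ}

/-- Each component is a SLICE of `WeilClassesWeilTypeCM` (drop the polarization and its discriminant).
[cite: Deligne1982HodgeCycles, §4 p. 30 (1)] -/
theorem weilClassesComponentCM_of_weilClassesWeilTypeCM (h : WeilClassesWeilTypeCM) (he : 2 ≤ e₀)
    (δ : cmNormResidueGroup R) : WeilClassesComponentCM R e₀ k δ :=
  fun A η _ hW _ _ _ c hc hcQ hcH ↦ h A η R e₀ k he hW c hc hcQ hcH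

/-- ON-PATH (W2-CM): every component target is a case of the summit. [cite: Deligne2000, §1] -/
theorem weilClassesComponentCM_of_hodgeConjecture (h : _root_.HodgeConjecture) (δ : cmNormResidueGroup R) :
    WeilClassesComponentCM R e₀ k δ :=
  fun _ _ _ hW _ _ _ c _ hcQ hcH ↦ (h hW.isSmoothProjective).2 k c hcQ hcH

/-- ON-PATH (W7-CM): the δ-restricted variational leaf is a case of the summit (fibrewise).
[cite: CharlesSchnell2014Notes, Cor. 11.3.6 (p. 479)] -/
theorem weilVariationalHodgeComponentCM_of_hodgeConjecture (h : _root_.HodgeConjecture) (δ : cmNormResidueGroup R) :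
    WeilVariationalHodgeComponentCM R e₀ k δ :=
  fun _ _ _ hf _ _ _ _ _ hW _ _ s ↦ (h (hf.isSmoothProjective s)).2 k _ (hW s).1 (hW s).2

/-- ON-PATH: the T6(δ)-CM target is a case of the summit. [cite: Deligne2000, §1] -/
theorem hodgeGeneralWeilTypeComponentCM_of_hodgeConjecture (h : _root_.HodgeConjecture) (δ : cmNormResidueGroup R) :
    HodgeGeneralWeilTypeComponentCM R e₀ k δ :=
  fun _ _ _ hW _ _ _ _ ↦ h hW.isSmoothProjective

/-- T6(δ)-CM is a slice of row T6-CM (`Ring2Transport.HodgeGeneralWeilTypeCMField`), for `e₀ ≥ 2`.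
[cite: Deligne1982HodgeCycles, §4 (4.4) and Milne 2003 re-edition endnote 16] -/
theorem hodgeGeneralWeilTypeComponentCM_of_hodgeGeneralWeilTypeCMField (h : HodgeGeneralWeilTypeCMField)
    (he : 2 ≤ e₀) (δ : cmNormResidueGroup R) : HodgeGeneralWeilTypeComponentCM R e₀ k δ :=
  fun A η h' hW hpol hRos _ hSU ↦ h A η R e₀ k h' he hW hpol hRos hSU

/-- W7-CM: R3var (`WeilTypeLadder.WeilVariationalHodgeCMField`, at `P = R(T²)`, `e = 2e₀`, `m = k`) implies the
δ-restricted leaf — forget the polarizations of the charts; the CM-field data of `P` are read off the chart of any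
fibre (`IsWeilTypeCM`). [cite: CharlesSchnell2014Notes, Conj. 11.3.1] [cite: Deligne1982HodgeCycles, §4 p. 30] -/
theorem weilVariationalHodgeComponentCM_of_weilVariationalHodgeCMField (hV : WeilVariationalHodgeCMField)
    (δ : cmNormResidueGroup R) : WeilVariationalHodgeComponentCM R e₀ k δ := by
  intro 𝒳 S f hf h𝒳 hS hirr hsm W hW hch hs₀ s
  obtain ⟨A', η', e', h', hW', hmem, -, -, -⟩ := hch s
  have hdim : 2 * e₀ * k = 2 * k * e₀ := Nat.mul_right_comm 2 e₀ k
  refine hV (R.comp (Polynomial.X ^ 2)) (2 * e₀) k hW'.monic_comp hW'.natDegree_comp hW'.irreducible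
    (fun _ hρ ↦ conj_ne_self_of_root_weilTypeCM hW' hρ) (exists_conj_polynomial_weilTypeCM hW') hW'.k_pos f
    (hdim ▸ hf) h𝒳 hS hirr hsm W (fun t ↦ ⟨(hW t).1, hdim ▸ (hW t).2⟩) (fun t ↦ ?_) hs₀ s
  obtain ⟨A'', η'', e'', h'', hW'', hmem'', -, -, -⟩ := hch t
  exact ⟨A'', η'', e'', hW''.eval₂_eq_zero, hW''.degree_mul_rank, hmem''⟩

/-- `WeilClassesWeilTypeCM` ⟹ all components. [cite: Deligne1982HodgeCycles, §4 p. 30 (1)] -/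
theorem weilClassesByComponentCM_of_weilClassesWeilTypeCM (h : WeilClassesWeilTypeCM) : WeilClassesByComponentCM :=
  fun _ _ _ _ δ he ↦ weilClassesComponentCM_of_weilClassesWeilTypeCM h he δ

/-- ON-PATH: `HodgeConjecture → WeilClassesByComponentCM`. [cite: Deligne2000, §1] -/
theorem weilClassesByComponentCM_of_hodgeConjecture (h : _root_.HodgeConjecture) : WeilClassesByComponentCM :=
  fun _ _ _ _ δ _ ↦ weilClassesComponentCM_of_hodgeConjecture h δ

end Slices

/-- W3-CM (←): granted the typed supply statement, the components EXHAUST `WeilClassesWeilTypeCM` — every Weil-type CM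
datum sits on some component `(E, 2k, δ)`. [cite: Deligne1982HodgeCycles, §4 p. 30 (1), Lemma 4.6 and Thm. 4.8 (a)] -/
theorem weilClassesWeilTypeCM_of_byComponentCM (hE : PolarizedWeilDiscriminantCMExists)
    (h : WeilClassesByComponentCM) : WeilClassesWeilTypeCM := by
  intro A η R e₀ k he hW c hc hcQ hcH
  haveI := hW.fact_irreducible_map_real
  obtain ⟨h', δ, hpol, hRos, hδ⟩ := hE R A η e₀ k hW
  exact h R e₀ k δ he A η h' hW hpol hRos hδ c hc hcQ hcH

/-- **W3-CM — EXACTNESS of the δ-indexing**: granted `PolarizedWeilDiscriminantCMExists` (typed), rung R3 on Deligne's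
carriers is EQUIVALENT to the conjunction of the component targets. [cite: Deligne1982HodgeCycles, §4 p. 30 (1) and Lemma 4.6] -/
theorem weilClassesWeilTypeCM_iff_byComponentCM (hE : PolarizedWeilDiscriminantCMExists) :
    WeilClassesWeilTypeCM ↔ WeilClassesByComponentCM :=
  ⟨weilClassesByComponentCM_of_weilClassesWeilTypeCM, weilClassesWeilTypeCM_of_byComponentCM hE⟩

/-- **R3 on Deligne's carriers ⟹ row T6-CM, granted #24 and MZ only** (descent input = theorem).
[cite: Deligne1982HodgeCycles, §4 (4.4) and Milne 2003 re-edition endnote 16] [cite: MoonenZarhin1998WeilClasses, §1] -/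
theorem hodgeGeneralWeilTypeCMField_of_weilClassesWeilTypeCM
    (h24 : Deligne1982_hodgeRing_weilTypeCM_of_hodgeGroupSU) (hMZ : MoonenZarhin1998_weilClasses_hodgeCriterion)
    (h : WeilClassesWeilTypeCM) : HodgeGeneralWeilTypeCMField :=
  fun A η R e₀ k _ he hW hpol hRos hSU ↦
    hodgeConjectureFor_weilTypeCM_of_rational h24 hMZ hW hpol hRos hSU
      (weilClassesField_le_span_isRationalClass hW.irreducible hW.eval₂_eq_zero (2 * k)) (h A η R e₀ k he hW)

section ConstantFamily

variable {R : Polynomial ℤ} [Fact (Irreducible (realPolyQ R))] {e₀ k : ℕ}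

/-- **Under HC the anchored δ-leaf holds**: the CONSTANT family `A.X ⟶ Spec ℂ` anchored at `A` itself, every fibre
charted by `(A, η, h)` with its discriminant datum (fibre inclusions are isomorphisms). So
`AnchoredWeilFamiliesComponentCM` IS a case of the summit. [folklore] -/
theorem anchoredWeilFamiliesComponentCM_of_hodgeConjecture (hHC : _root_.HodgeConjecture)
    (δ : cmNormResidueGroup R) : AnchoredWeilFamiliesComponentCM R e₀ k δ := by
  intro A η h hW hpol hRos hδ c hc hcQ hcH _
  have hX : IsSmoothProjective (2 * k * e₀) A.X := hW.dim_eq ▸ hW.isSmoothProjective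
  have hfam : IsSmoothProjectiveFamily (toSpecOver A.X) (2 * k * e₀) := isSmoothProjectiveFamily_toSpecOver' hX
  let s : ComplexPoints (specOver ℂ ℂ) := 𝟙 (specOver ℂ ℂ)
  haveI : ∀ t : ComplexPoints (specOver ℂ ℂ), IsIso (fiberι (toSpecOver A.X) t) :=
    fun t => isIso_fiberι_toSpecOver' (X := A.X) t
  let ι : A.X ≅ fiberOver (toSpecOver A.X) s := (asIso (fiberι (toSpecOver A.X) s)).symm
  have halg : c ∈ algebraicClasses A.X k := (hHC hW.isSmoothProjective).2 k c hcQ hcH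
  have hcH' : IsOfHodgeType (2 * k * e₀) A.X (2 * k) k k c := hW.dim_eq ▸ hcH
  have hback : ∀ t : ComplexPoints (specOver ℂ ℂ),
      complexBetti.map (asIso (fiberι (toSpecOver A.X) t)).symm.hom (2 * k)
        (complexBetti.map (fiberι (toSpecOver A.X) t) (2 * k) c) = c := fun t => by
    change (complexBetti.map (asIso (fiberι (toSpecOver A.X) t)).hom (2 * k) ≫
      complexBetti.map (asIso (fiberι (toSpecOver A.X) t)).inv (2 * k)) c = c
    rw [← complexBetti.map_comp, Iso.inv_hom_id, complexBetti.map_id]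
    rfl
  refine ⟨A.X, specOver ℂ ℂ, toSpecOver A.X, s, s, ι, c, hfam,
    IsQuasiProjectiveOver.of_isProjectiveOver hX.isProjectiveOver, IsQuasiProjectiveOver.specOver,
    inferInstanceAs (IrreducibleSpace (PrimeSpectrum ℂ)), ?_, ?_, ?_, hback s, ?_⟩
  · haveI : IsIso (specOver ℂ ℂ).hom := by rw [specOver_hom_eq_id]; exact IsIso.id _
    infer_instance
  · intro t
    exact ⟨hcQ.pullback _, IsOfHodgeType.map_of_iso (asIso (fiberι (toSpecOver A.X) t)) hcH'⟩
  · intro t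
    refine ⟨A, η, (asIso (fiberι (toSpecOver A.X) t)).symm, h, hW, ?_, hpol, hRos, hδ⟩
    rw [hback t]
    exact hc
  · change complexBetti.map (fiberι (toSpecOver A.X) s) (2 * k) c ∈ algebraicClasses _ k
    exact (mem_algebraicClasses_map_iff_of_iso (asIso (fiberι (toSpecOver A.X) s))).2 halg

end ConstantFamily

/-! ### §4 T6(δ)-CM: the general member of the component -/

section GeneralMember

variable {R : Polynomial ℤ} [Fact (Irreducible (realPolyQ R))] {e₀ k : ℕ} {δ : cmNormResidueGroup R}

/-- **T6(δ)-CM from the component target, fact #24 (UNREFEREED endnote for `e₀ ≥ 2`) and Moonen–Zarhin** — the descent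
input being the THEOREM `HodgeTheory.weilClassesField_le_span_isRationalClass`: on the general member the rational
`(k,k)` Weil classes are algebraic by the component target, they span `W_E ⊗ ℂ` (theorem), which is of type `(k,k)`
(MZ), and the endnote closes the Hodge ring. [cite: Deligne1982HodgeCycles, §4 (4.4), Prop. 4.4 and Milne 2003 re-edition endnote 16]
[cite: MoonenZarhin1998WeilClasses, §1 (Criterion; W_F ⊗ ℂ)] -/
theorem hodgeGeneralWeilTypeComponentCM_of_weilClassesComponentCM
    (h24 : Deligne1982_hodgeRing_weilTypeCM_of_hodgeGroupSU) (hMZ : MoonenZarhin1998_weilClasses_hodgeCriterion)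
    (hWδ : WeilClassesComponentCM R e₀ k δ) : HodgeGeneralWeilTypeComponentCM R e₀ k δ :=
  fun A η h hW hpol hRos hδ hSU ↦
    hodgeConjectureFor_weilTypeCM_of_rational h24 hMZ hW hpol hRos hSU
      (weilClassesField_le_span_isRationalClass hW.irreducible hW.eval₂_eq_zero (2 * k))
      fun c hc hcQ hcH ↦ hWδ A η h hW hpol hRos hδ c hc hcQ hcH

/-- **Row T6(δ)-CM with `HC_CM`**: `HC_CM → CMPointedWeilFamiliesComponentCM → WeilVariationalHodgeComponentCM → (#24) →
(MZ) → HodgeGeneralWeilTypeComponentCM` (`HC_CM` nominal: replace the first two binders by the divisor-generated leaf).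
[cite: Deligne1982HodgeCycles, §4 (4.4) and Milne 2003 re-edition endnote 16] [cite: CharlesSchnell2014Notes, Conj. 11.3.1] -/
theorem hodgeGeneralWeilTypeComponentCM_of_HC_CM (hCM : Theses.RankFourFaces.CMAbelianHodge)
    (hP : CMPointedWeilFamiliesComponentCM R e₀ k δ) (hV : WeilVariationalHodgeComponentCM R e₀ k δ)
    (h24 : Deligne1982_hodgeRing_weilTypeCM_of_hodgeGroupSU) (hMZ : MoonenZarhin1998_weilClasses_hodgeCriterion) :
    HodgeGeneralWeilTypeComponentCM R e₀ k δ :=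
  hodgeGeneralWeilTypeComponentCM_of_weilClassesComponentCM h24 hMZ (weilClassesComponentCM_of_HC_CM hCM hP hV)

end GeneralMember

end Summit.HodgeConjecture.HodgeConjecture.Ring2.Hypotheses

end
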